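import Mathlib
import Summits.ResolutionOfSingularities.ResolutionOfSingularities.Theorems.HomologicalConductorPersistenceCyclicQuotientIsotypic
import HarnessLib

/-!
# Rung S-2 `PersistenceSurface` (stmt-19970), stub C1 (`Sat₄`) — the ISOTYPIC PIECES `M_a` of `k[u,v]` over
# `U = k[u,v]^{μ_n(1,q)}`: support characterisation and FINITE GENERATION
# (chain W4.4b, seat res-L1-w44b-stub-4 gen 6; T-V package part 19)

[OURS · L1 w44b · rung S-2] Nothing here is a statement of the manuscript under review (Hironaka 2017);
AI-written, weaker than expert review.

Part 18 (`…PersistenceCyclicQuotientIsotypic.exists_isotypic_splitting`) splits `k[u,v]|_U ≅ Π_a M_a` into the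
`σ₀`-eigen-submodules `M_a = {p | σ₀ p = ζ^a p}` and assembles the `Sat₄` certificate from per-piece syzygy data,
leaving the instance hypothesis «the distinguished pieces `M (ψ t)` are finitely generated».  This file describes the
pieces concretely and discharges that hypothesis:

* `pow_eq_pow_iff_modEq_of_isPrimitiveRoot` — `ζ^a = ζ^b ↔ a ≡ b (mod n)` for a primitive `n`-th root `ζ`;
  `coeff_rootAut` — `σ₀` acts coefficientwise by `ζ^{d₀ + q d₁}`;
  **`rootAut_eq_C_mul_iff`** — `σ₀ p = ζ^a · p ↔` every monomial `u^{d₀}v^{d₁}` in the support of `p` has weight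
  `d₀ + q d₁ ≡ a (mod n)`: `M_a` is the `k`-span of the monomials of weight class `a` (the engines' `M_χ`).
* `monomial_mem_isotypic` — `uⁱvʲ ∈ M_{i+qj}`; **`isotypic_le_span`** / **`finite_isotypic`** — `M_a` is generated
  over `U` by the `≤ n²` monomials `uⁱvʲ` (`monomial (single 0 i + single 1 j) 1`), `i, j < n`, `i + qj ≡ a`; hence `Module.Finite U (M a)` for every `a`.
* With `finite_isotypic` the instance hypothesis of part 18's `cohomologyAnnihilator_eq_four_of_isotypicData` is
  discharged for the canonical pieces (`M := fun a => ModuleCat.of U (M a)`): the per-`(n,q)` inputs of the `Sat₄`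
  certificate are now exactly (a) first syzygies `K a` of the pieces with `K a ∈ add ((Π t, M (ψ t)) ⊕ U)` and (b)
  retracts `M (ψ t) | K (ψ (s t))` — res-L1-w44b-idea-1 SC-TORIC §2(e) (4) and (5).

References: folklore (semi-invariants of a diagonal cyclic action); Iyengar–Takahashi, IMRN 2016, arXiv:1404.1476
[`IyengarTakahashi2014`] (vocabulary only).
-/

-- single-problem summit: the doubled namespace component `ResolutionOfSingularities` is forced
set_option linter.dupNamespace false

noncomputable section

open CategoryTheory Literature.RingTheory.CohomologyAnnihilator MvPolynomial
open Summit.ResolutionOfSingularities.ResolutionOfSingularities.Theorems.NoZeno.SandwichCluster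
open Summit.ResolutionOfSingularities.ResolutionOfSingularities.Theorems.HomologicalConductor.PersistenceCyclicQuotientSurface
open Summit.ResolutionOfSingularities.ResolutionOfSingularities.Theorems.HomologicalConductor.PersistenceCyclicQuotientSurfaceFinite
open Summit.ResolutionOfSingularities.ResolutionOfSingularities.Theorems.HomologicalConductor.PersistenceAddCoverFamily
open Summit.ResolutionOfSingularities.ResolutionOfSingularities.Theorems.HomologicalConductor.PersistenceCyclicQuotientAddCover
open Summit.ResolutionOfSingularities.ResolutionOfSingularities.Theorems.HomologicalConductor.PersistenceCyclicQuotientIsotypic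

universe u

namespace Summit.ResolutionOfSingularities.ResolutionOfSingularities.Theorems.HomologicalConductor.PersistenceCyclicQuotientIsotypicPieces

variable {k : Type u} [Field k]

/-! ## `σ₀` coefficientwise; the support characterisation of `M_a` -/

/-- For a primitive `n`-th root of unity: `ζ^a = ζ^b ↔ a ≡ b (mod n)`. [folklore] -/
theorem pow_eq_pow_iff_modEq_of_isPrimitiveRoot {n : ℕ} [NeZero n] {ζ : k} (hζ : IsPrimitiveRoot ζ n)
    (a b : ℕ) : ζ ^ a = ζ ^ b ↔ a ≡ b [MOD n] := by
  constructor
  · intro h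
    have hnpos : 0 < n := Nat.pos_of_ne_zero (NeZero.ne n)
    have ha : ζ ^ a = ζ ^ (a % n) := pow_eq_pow_of_modEq hζ.pow_eq_one (Nat.mod_modEq a n).symm
    have hb : ζ ^ b = ζ ^ (b % n) := pow_eq_pow_of_modEq hζ.pow_eq_one (Nat.mod_modEq b n).symm
    rw [ha, hb] at h
    exact hζ.pow_inj (Nat.mod_lt _ hnpos) (Nat.mod_lt _ hnpos) h
  · exact pow_eq_pow_of_modEq hζ.pow_eq_one

/-- `σ₀ = (u ↦ ζu, v ↦ ζ^q v)` acts COEFFICIENTWISE: `coeff_d (σ₀ p) = ζ^{d₀ + q d₁} coeff_d p`. [folklore] -/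
theorem coeff_rootAut (ζ : k) (q : ℕ) (p : MvPolynomial (Fin 2) k) (d : Fin 2 →₀ ℕ) :
    coeff d (aeval (fun i : Fin 2 => C (ζ ^ (![1, q] : Fin 2 → ℕ) i) * X i) p) = ζ ^ (d 0 + q * d 1) * coeff d p := by
  conv_lhs => rw [p.as_sum, map_sum]
  rw [coeff_sum]
  simp only [rootAut_monomial, coeff_C_mul, coeff_monomial]
  rw [Finset.sum_eq_single d (fun d' _ hne => by rw [if_neg hne, mul_zero]) (fun hd => by
    rw [if_pos rfl, notMem_support_iff.mp hd, mul_zero])]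
  rw [if_pos rfl]

/-- **Support characterisation of the isotypic piece `M_a`**: `σ₀ p = ζ^a · p` iff every monomial `u^{d₀}v^{d₁}` in
the support of `p` has weight `d₀ + q d₁ ≡ a (mod n)` (`ζ` a primitive `n`-th root). [folklore] -/
theorem rootAut_eq_C_mul_iff {n : ℕ} [NeZero n] {ζ : k} (hζ : IsPrimitiveRoot ζ n) (q : ℕ) (a : ZMod n)
    (p : MvPolynomial (Fin 2) k) :
    aeval (fun i : Fin 2 => C (ζ ^ (![1, q] : Fin 2 → ℕ) i) * X i) p = C (ζ ^ a.val) * p ↔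
      ∀ d ∈ p.support, ((d 0 + q * d 1 : ℕ) : ZMod n) = a := by
  have key : ∀ d : Fin 2 →₀ ℕ, ((d 0 + q * d 1 : ℕ) : ZMod n) = a ↔ ζ ^ (d 0 + q * d 1) = ζ ^ a.val := by
    intro d
    rw [pow_eq_pow_iff_modEq_of_isPrimitiveRoot hζ, ← ZMod.natCast_eq_natCast_iff, ZMod.natCast_val, ZMod.cast_id',
      id]
  constructor
  · intro h d hd
    have hc := congr_arg (coeff d) h
    rw [coeff_rootAut, coeff_C_mul] at hc
    have hne : coeff d p ≠ 0 := mem_support_iff.mp hd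
    exact (key d).mpr (mul_right_cancel₀ hne hc)
  · intro h
    apply MvPolynomial.ext
    intro d
    rw [coeff_rootAut, coeff_C_mul]
    by_cases hd : d ∈ p.support
    · rw [(key d).mp (h d hd)]
    · rw [notMem_support_iff.mp hd, mul_zero, mul_zero]

/-! ## The pieces are finitely generated over `U` -/

section Pieces

variable {n : ℕ} [NeZero n] {ζ : k} (hζ : IsPrimitiveRoot ζ n) (q : ℕ) (U : Subalgebra k (MvPolynomial (Fin 2) k))
variable (hU : ∀ p, p ∈ U ↔ aeval (fun i : Fin 2 => C (ζ ^ (![1, q] : Fin 2 → ℕ) i) * X i) p = p)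
variable (M : ZMod n → Submodule U ((restrictScalarsFunctor U (MvPolynomial (Fin 2) k)).obj
  (ModuleCat.of (MvPolynomial (Fin 2) k) (MvPolynomial (Fin 2) k))))
variable (hM : ∀ (a : ZMod n) (p : MvPolynomial (Fin 2) k),
  (show ((restrictScalarsFunctor U (MvPolynomial (Fin 2) k)).obj
    (ModuleCat.of (MvPolynomial (Fin 2) k) (MvPolynomial (Fin 2) k))) from p) ∈ M a ↔
  aeval (fun i : Fin 2 => C (ζ ^ (![1, q] : Fin 2 → ℕ) i) * X i) p = C (ζ ^ a.val) * p)

include hζ hM in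
/-- **Monomials are semi-invariants**: `uⁱvʲ` (times a constant) lies in the piece `M_{i + qj}`. [folklore] -/
theorem monomial_mem_isotypic (d : Fin 2 →₀ ℕ) (c : k) :
    (show ((restrictScalarsFunctor U (MvPolynomial (Fin 2) k)).obj
      (ModuleCat.of (MvPolynomial (Fin 2) k) (MvPolynomial (Fin 2) k))) from monomial d c) ∈
      M ((d 0 + q * d 1 : ℕ) : ZMod n) := by
  classical
  rw [hM, rootAut_eq_C_mul_iff hζ]
  intro d' hd'
  rw [support_monomial] at hd'
  split_ifs at hd' with hc
  · exact absurd hd' (Finset.notMem_empty _)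
  · rw [Finset.mem_singleton] at hd'
    rw [hd']

include hζ hU hM in
/-- **`M_a` is generated over `U` by the monomials `uⁱvʲ` with `i, j < n` and `i + qj ≡ a`** (write
`u^{d₀}v^{d₁} = (u^{n⌊d₀/n⌋}v^{n⌊d₁/n⌋}) · u^{d₀ mod n}v^{d₁ mod n}`, the first factor invariant). [folklore] -/
theorem isotypic_le_span (a : ZMod n) :
    M a ≤ Submodule.span U ((fun ij : ℕ × ℕ => (show ((restrictScalarsFunctor U (MvPolynomial (Fin 2) k)).obj
        (ModuleCat.of (MvPolynomial (Fin 2) k) (MvPolynomial (Fin 2) k))) from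
          monomial (Finsupp.single 0 ij.1 + Finsupp.single 1 ij.2) 1)) ''
      ↑((Finset.range n ×ˢ Finset.range n).filter fun ij => ((ij.1 + q * ij.2 : ℕ) : ZMod n) = a)) := by
  classical
  intro w hw
  -- the identity `V → V|_U` as an additive map, to rewrite `w` as a sum of monomial terms inside `V|_U`
  let toWh : MvPolynomial (Fin 2) k →+ ((restrictScalarsFunctor U (MvPolynomial (Fin 2) k)).obj
      (ModuleCat.of (MvPolynomial (Fin 2) k) (MvPolynomial (Fin 2) k))) :=
    { toFun := fun p => p, map_zero' := rfl, map_add' := fun _ _ => rfl }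
  let ofW : ((restrictScalarsFunctor U (MvPolynomial (Fin 2) k)).obj
      (ModuleCat.of (MvPolynomial (Fin 2) k) (MvPolynomial (Fin 2) k))) → MvPolynomial (Fin 2) k := fun w => w
  have hsupp : ∀ d ∈ (ofW w).support, ((d 0 + q * d 1 : ℕ) : ZMod n) = a :=
    (rootAut_eq_C_mul_iff hζ q a (ofW w)).mp ((hM a (ofW w)).mp hw)
  have hnpos : 0 < n := Nat.pos_of_ne_zero (NeZero.ne n)
  have hw' : w = toWh (∑ d ∈ (ofW w).support, monomial d (coeff d (ofW w))) :=
    congr_arg toWh (ofW w).as_sum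
  rw [hw', map_sum]
  refine Submodule.sum_mem _ fun d hd => ?_
  -- `monomial d c = (c · u^{n⌊d₀/n⌋} v^{n⌊d₁/n⌋}) • (u^{d₀ mod n} v^{d₁ mod n})`
  let e : Fin 2 →₀ ℕ := Finsupp.single 0 (n * (d 0 / n)) + Finsupp.single 1 (n * (d 1 / n))
  have heU : monomial e (coeff d (ofW w)) ∈ U :=
    monomial_mul_mem hζ q U hU e _ (by simp [e]) (by simp [e])
  have hexp : e + (Finsupp.single 0 (d 0 % n) + Finsupp.single 1 (d 1 % n)) = d := by
    ext i; fin_cases i <;> simp [e, Nat.div_add_mod]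
  have hdecomp : toWh (monomial d (coeff d (ofW w))) = (⟨monomial e (coeff d (ofW w)), heU⟩ : U) •
      toWh (monomial (Finsupp.single 0 (d 0 % n) + Finsupp.single 1 (d 1 % n)) 1) := by
    change monomial d (coeff d (ofW w)) =
      monomial e (coeff d (ofW w)) * monomial (Finsupp.single 0 (d 0 % n) + Finsupp.single 1 (d 1 % n)) 1
    rw [monomial_mul, mul_one, hexp]
  rw [hdecomp]
  refine Submodule.smul_mem _ _ (Submodule.subset_span ⟨(d 0 % n, d 1 % n), ?_, rfl⟩)
  rw [Finset.mem_coe, Finset.mem_filter]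
  refine ⟨by simp [Nat.mod_lt _ hnpos], ?_⟩
  rw [← hsupp d hd]
  push_cast
  have h0 : ((d 0 : ℕ) : ZMod n) = ((d 0 % n : ℕ) : ZMod n) := by
    rw [ZMod.natCast_eq_natCast_iff]; exact (Nat.mod_modEq _ _).symm
  have h1 : ((d 1 : ℕ) : ZMod n) = ((d 1 % n : ℕ) : ZMod n) := by
    rw [ZMod.natCast_eq_natCast_iff]; exact (Nat.mod_modEq _ _).symm
  rw [h0, h1]

include hζ hU hM in
/-- **`M_a` IS the `U`-span of the monomials `uⁱvʲ`, `i, j < n`, `i + qj ≡ a`.** [folklore] -/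
theorem isotypic_eq_span (a : ZMod n) :
    M a = Submodule.span U ((fun ij : ℕ × ℕ => (show ((restrictScalarsFunctor U (MvPolynomial (Fin 2) k)).obj
        (ModuleCat.of (MvPolynomial (Fin 2) k) (MvPolynomial (Fin 2) k))) from
          monomial (Finsupp.single 0 ij.1 + Finsupp.single 1 ij.2) 1)) ''
      ↑((Finset.range n ×ˢ Finset.range n).filter fun ij => ((ij.1 + q * ij.2 : ℕ) : ZMod n) = a)) := by
  classical
  refine le_antisymm (isotypic_le_span hζ q U hU M hM a) (Submodule.span_le.mpr ?_)
  rintro _ ⟨ij, hij, rfl⟩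
  rw [Finset.mem_coe, Finset.mem_filter] at hij
  have h := monomial_mem_isotypic hζ q U M hM (Finsupp.single 0 ij.1 + Finsupp.single 1 ij.2) 1
  have hwt : (((Finsupp.single 0 ij.1 + Finsupp.single 1 ij.2 : Fin 2 →₀ ℕ) 0 +
      q * (Finsupp.single 0 ij.1 + Finsupp.single 1 ij.2 : Fin 2 →₀ ℕ) 1 : ℕ) : ZMod n) = a := by
    rw [← hij.2]; simp
  rw [hwt] at h
  exact h

include hζ hU hM in
/-- **Every isotypic piece `M_a` is a finitely generated `U`-module** (hence the instance hypothesis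
`[∀ t, Module.Finite U (M (ψ t))]` of part 18's `cohomologyAnnihilator_eq_four_of_isotypicData` is discharged for
the canonical pieces: apply it with `fun a => ModuleCat.of U (M a)` and `finite_isotypic`). [folklore] -/
theorem finite_isotypic (a : ZMod n) : Module.Finite U (M a) := by
  classical
  rw [Module.Finite.iff_fg, isotypic_eq_span hζ q U hU M hM a]
  exact Submodule.fg_span ((Finset.finite_toSet _).image _)

end Pieces


end Summit.ResolutionOfSingularities.ResolutionOfSingularities.Theorems.HomologicalConductor.PersistenceCyclicQuotientIsotypicPieces

end
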